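import Summits.CriticalPhenomena.PercolationContinuityZ3.Theorems.Transplant.BccClawXLegs
import Summits.CriticalPhenomena.PercolationContinuityZ3.Theorems.Transplant.BccSlabProfiles
import HarnessLib

/-!
# The bcc (001)-slabs, exit-form routing certificate for THICKNESS `k = 2`, II: TWINS — the column-level routing statement `ColRoutingTwin` with the
# side conditions the terminal data impose on STACKED terminals when `k = 2`, and the reduction of `ShapedLinkageX 3 (BccSlab.sqShadow 2)` to it

builds on p205010 (kernel theorem, internal audit signed; external expert review pending) — NOT used in this file.
Lane `prim-bschramm`, seat `prim-bschramm-p2` (gen 47; class C1b = films / other 3D lattices at their own critical point, METHOD = input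
substitution; memo `HOME/bschramm/P2-LATTICES.md` §157); helper file (`--supports stmt-CriticalPhenomena-4575 --as helper`).

WHY.  For `k ≥ 3` the reduction «BccSlabClearedSetX».`shapedLinkageX_of_colRouting` keeps only COLUMN conditions on the terminal triple; for `k = 2`
the resulting statement `ColRouting 2` is false (twins `E₁ = (a,0)`, `E₂ = (a,2)` over a column with a single usable neighbour column admit no swap
pair), but the offending triples are never certified by `TerminalsX`.  In `S_2(bcc)` a column `a` carries the two vertices `(a,0)`, `(a,2)` when `a₀ + a₁`
is even and the single vertex `(a,1)` otherwise (§1: `ht_eq_one_of_odd`, `eq_of_sh_eq_of_odd`, `even_of_twins`).  If the certified terminals `E₁ ≠ E₂`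
are STACKED (`sh E₁ = sh E₂ = a`: twins), the four vertices `o₁ → E₁ → a₁`, `a₂ → E₂ → o₂` of `γ_min` around them lie in the four ODD neighbour columns
of `a`, one vertex each, so they OCCUPY ALL FOUR neighbour columns (`a₁ = a₂` would put `a` next to the centre, where no exterior column is in reach):
hence (§2) the exit column `sh w'` is NOT adjacent to `a`, and `a` has two distinct EXTERIOR neighbour columns (those of `o₁ ≠ o₂ ∉ W`).
* §2 **`BccSlab.ColRoutingTwin k`** (column-level routing with these twin side conditions; weaker than «BccSlabClearedSetX».`ColRouting k`) and
  **`BccSlab.shapedLinkageX_two_of_colRoutingTwin`**: `ColRoutingTwin 2 → (sqShadow 2).ShapedLinkageX 3` (cleared set `lift (block ∖ corner columns)`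
  as for `k ≥ 3`); `theta_criticalProb_eq_zero_two_of_colRoutingTwin`.
`ColRoutingTwin 2` is discharged by the parity-aware claw table «BccClawX2Table*» and the even-hub template «BccSlabTwoHub» in «BccSlabTwoRoute».
[cite: DuminilCopinSidoraviciusTassion2016, §2.3 (proof of Fact 2: u', v', w' and the three disjoint paths in B̄_R(z))] [cite: ConwaySloane1999, Ch. 4 §7.1]
-/

noncomputable section

namespace Summit.CriticalPhenomena.PercolationContinuityZ3.Theorems.Transplant

namespace BccSlab

open Literature.Probability.Percolation Literature.Probability.LatticeModels SimpleGraph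
open scoped Classical

variable {k : ℕ}

/-! ## §1 Columns of `S_2(bcc)`: one vertex over odd columns, twins over even columns -/

/-- Over a column `a` with `a₀ + a₁` odd, a vertex of `S_2(bcc)` has height `1`. [cite: ConwaySloane1999, Ch. 4 §7.1] -/
theorem ht_eq_one_of_odd (x : bslab 2) (hodd : ¬ Even (sh x 0 + sh x 1)) : ht x = 1 := by
  obtain ⟨h0, h2, ⟨m, hm⟩⟩ := adm_sh_ht x
  push_cast at h2
  rcases Int.even_or_odd (ht x) with ⟨r, hr⟩ | ⟨r, hr⟩
  · exact absurd ⟨m + r, by omega⟩ hodd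
  · omega

/-- **Over an odd column there is only one vertex** (`k = 2`). [cite: ConwaySloane1999, Ch. 4 §7.1] -/
theorem eq_of_sh_eq_of_odd {x y : bslab 2} (hs : sh x = sh y) (hodd : ¬ Even (sh x 0 + sh x 1)) : x = y :=
  eq_of_sh_eq_of_height_eq hs (by
    have h1 := ht_eq_one_of_odd x hodd
    have h2 := ht_eq_one_of_odd y (by rw [← hs]; exact hodd)
    unfold ht at h1 h2; rw [h1, h2])

/-- **Two distinct vertices over one column are twins over an EVEN column** (`k = 2`). [cite: ConwaySloane1999, Ch. 4 §7.1] -/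
theorem even_of_twins {E₁ E₂ : bslab 2} (hne : E₁ ≠ E₂) (hs : sh E₁ = sh E₂) : Even (sh E₁ 0 + sh E₁ 1) := by
  by_contra hodd
  exact hne (eq_of_sh_eq_of_odd hs hodd)

/-- Along a slab bond the column parity flips: a neighbour of a vertex over an even column lies over an odd column (any `k`). [folklore] -/
theorem odd_of_adj_even {x o : bslab k} (hadj : (slabGraph k).Adj x o) (he : Even (sh x 0 + sh x 1)) : ¬ Even (sh o 0 + sh o 1) := by
  obtain ⟨m, hm⟩ := he
  rintro ⟨r, hr⟩
  rcases sum_step_of_adj (sh_step hadj) with h | h <;> omega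

/-- Distinct neighbours of twins lie over distinct columns (`k = 2`). [folklore] -/
theorem sh_ne_of_adj_twins {E E' x y : bslab 2} (hE : Even (sh E 0 + sh E 1)) (hs : sh E = sh E') (hx : (slabGraph 2).Adj E x)
    (hy : (slabGraph 2).Adj E' y) (hne : x ≠ y) : sh x ≠ sh y := by
  intro hxy
  have hox : ¬ Even (sh x 0 + sh x 1) := odd_of_adj_even hx hE
  have _hoy : ¬ Even (sh y 0 + sh y 1) := odd_of_adj_even hy (by rw [← hs]; exact hE)
  exact hne (eq_of_sh_eq_of_odd hxy hox)

/-- A column of `sqBall z 2` in the exit window is cleared (the block is clipped in at most one direction, so its corner columns have a coordinate at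
distance `3` from `z`). [folklore] -/
theorem mem_Dcols_of_sqBall_two {z : Site 2} {t s : ℕ} (hts : 3 ≤ t ∨ 3 ≤ s) {w : Site 2} (h2 : w ∈ sqBall z 2) (hwin : SqShadow.InWin z t s w) :
    w ∈ Dcols z t s := by
  rw [mem_sqBall_iff_linear] at h2
  obtain ⟨hw0, hw1⟩ := hwin
  refine ⟨?_, fun hc => ?_⟩
  · rw [mem_sqBlkR, mem_sqBall_iff_linear]; push_cast at h2 ⊢; exact ⟨by omega, hw0, hw1⟩
  · obtain ⟨h0, h1⟩ := mem_cornerCols.1 hc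
    push_cast at h2
    rcases hts with ht | hs
    · have hmin : min (t : ℤ) 3 = 3 := min_eq_right (by exact_mod_cast ht)
      rw [hmin] at h0; omega
    · have hmin : min (s : ℤ) 3 = 3 := min_eq_right (by exact_mod_cast hs)
      rw [hmin] at h1; omega

/-- Five pairwise distinct unit steps of `ℤ²` do not exist (kernel check over the four steps). [folklore] -/
theorem five_nbrs_false : ∀ r₁ ∈ BccClawX.nbrs ((0 : ℤ), (0 : ℤ)), ∀ r₂ ∈ BccClawX.nbrs ((0 : ℤ), (0 : ℤ)), ∀ r₃ ∈ BccClawX.nbrs ((0 : ℤ), (0 : ℤ)),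
    ∀ r₄ ∈ BccClawX.nbrs ((0 : ℤ), (0 : ℤ)), ∀ r₅ ∈ BccClawX.nbrs ((0 : ℤ), (0 : ℤ)),
    r₁ ≠ r₂ → r₁ ≠ r₃ → r₁ ≠ r₄ → r₁ ≠ r₅ → r₂ ≠ r₃ → r₂ ≠ r₄ → r₂ ≠ r₅ → r₃ ≠ r₄ → r₃ ≠ r₅ → r₄ ≠ r₅ → False := by
  decide

/-- The relative position of a lattice neighbour is one of the four unit steps. [folklore] -/
theorem rel_mem_nbrs_of_adj {A p : Site 2} (h : (zdGraph 2).Adj A p) : BccClawX.rel A p ∈ BccClawX.nbrs ((0 : ℤ), (0 : ℤ)) := by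
  have ha := BccClawX.adjb_rel (z := A) h
  simp only [BccClawX.adjb, BccClawX.rel, sub_self, Bool.or_eq_true, Bool.and_eq_true, decide_eq_true_eq] at ha
  simp only [BccClawX.nbrs, BccClawX.rel, List.mem_cons, List.not_mem_nil, or_false, Prod.ext_iff, zero_add, zero_sub]
  omega

/-- Five pairwise distinct lattice neighbours of one column do not exist. [folklore] -/
theorem not_five_nbrs {A p₁ p₂ p₃ p₄ p₅ : Site 2} (h₁ : (zdGraph 2).Adj A p₁) (h₂ : (zdGraph 2).Adj A p₂) (h₃ : (zdGraph 2).Adj A p₃)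
    (h₄ : (zdGraph 2).Adj A p₄) (h₅ : (zdGraph 2).Adj A p₅) (n12 : p₁ ≠ p₂) (n13 : p₁ ≠ p₃) (n14 : p₁ ≠ p₄) (n15 : p₁ ≠ p₅) (n23 : p₂ ≠ p₃)
    (n24 : p₂ ≠ p₄) (n25 : p₂ ≠ p₅) (n34 : p₃ ≠ p₄) (n35 : p₃ ≠ p₅) (n45 : p₄ ≠ p₅) : False := by
  have ne : ∀ {p q : Site 2}, p ≠ q → BccClawX.rel A p ≠ BccClawX.rel A q := by
    intro p q hpq h; exact hpq (by rw [← BccClawX.pt_rel A p, h, BccClawX.pt_rel])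
  exact five_nbrs_false _ (rel_mem_nbrs_of_adj h₁) _ (rel_mem_nbrs_of_adj h₂) _ (rel_mem_nbrs_of_adj h₃) _ (rel_mem_nbrs_of_adj h₄)
    _ (rel_mem_nbrs_of_adj h₅) (ne n12) (ne n13) (ne n14) (ne n15) (ne n23) (ne n24) (ne n25) (ne n34) (ne n35) (ne n45)

/-! ## §2 Column-level routing for `k = 2` and the reduction -/

/-- **COLUMN-LEVEL ROUTING WITH THE TWIN SIDE CONDITIONS** (what the parity-aware claw table and the even-hub template discharge at `k = 2`): as
«BccSlabClearedSetX».`ColRouting k`, but a swap pair is owed for STACKED terminals (`sh E₁ = sh E₂`) only under the two side conditions the terminal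
data force at `k = 2` — the exit column `sh w'` is not adjacent to their column, which has two distinct exterior neighbour columns.  Weaker than
`ColRouting k`; an internal obligation, never asserted. [cite: DuminilCopinSidoraviciusTassion2016, §2.3 (proof of Fact 2: the three disjoint paths in B̄_R(z))] -/
def ColRoutingTwin (k : ℕ) : Prop :=
  ∀ (z : Site 2) (tR tD sR sD : ℕ), tR ≤ tD → sR ≤ sD → (3 ≤ tR ∨ 3 ≤ sR) →
    ∀ (E₁ E₂ w' : bslab k), E₁ ≠ E₂ →
      sh E₁ ∈ tgtCols z tD sD → sh E₁ ∈ sqBlkR 3 z tR sR → sh E₁ ≠ z →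
      sh E₂ ∈ tgtCols z tD sD → sh E₂ ∈ sqBlkR 3 z tR sR → sh E₂ ≠ z →
      sh w' ∈ tgtCols z tD sD → sh w' ≠ sh E₁ → sh w' ≠ sh E₂ →
      (sh E₁ = sh E₂ → ¬ (zdGraph 2).Adj (sh E₁) (sh w') ∧
        ∃ O₁ O₂ : Site 2, O₁ ≠ O₂ ∧ (zdGraph 2).Adj (sh E₁) O₁ ∧ (zdGraph 2).Adj (sh E₁) O₂ ∧ O₁ ∈ extCols z tD sD ∧ O₂ ∈ extCols z tD sD) →
        ∃ r₁ r₂ : VRouteData (slabGraph k) (clearedSet k z tD sD ∩ (sqShadow k).lift (sqBlkR 3 z tR sR)) (clearedSet k z tD sD) E₁ E₂ w',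
          r₁.y = r₂.b ∧ r₁.b = r₂.y

/-- `ColRouting k` implies its twin-conditioned form (forget the side conditions). [folklore] -/
theorem colRoutingTwin_of_colRouting (H : ColRouting k) : ColRoutingTwin k :=
  fun z tR tD sR sD hRD hSE hone E₁ E₂ w' hne h1 h1R h1z h2 h2R h2z h3 h31 h32 _ =>
    H z tR tD sR sD hRD hSE hone E₁ E₂ w' hne h1 h1R h1z h2 h2R h2z h3 h31 h32

/-- **THE TWIN SIDE CONDITIONS from the terminal data** (`k = 2`, cleared set `lift (block ∖ corners)`): if the certified terminals are stacked, the exit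
column is not adjacent to their column, and that column has two distinct exterior neighbour columns. [cite: DuminilCopinSidoraviciusTassion2016, §2.3 (proof of Fact 2: u', v', w')] -/
theorem twin_conditions {z : Site 2} {tR tD sR sD : ℕ} (hsRD : sR ≤ sD) (hts : 3 ≤ tD ∨ 3 ≤ sD) {E₁ E₂ w' : bslab 2}
    (hT : (sqShadow 2).TerminalsX 3 z tR tD sR sD (clearedSet 2 z tD sD) E₁ E₂ w') (hs : sh E₁ = sh E₂) :
    ¬ (zdGraph 2).Adj (sh E₁) (sh w') ∧
      ∃ O₁ O₂ : Site 2, O₁ ≠ O₂ ∧ (zdGraph 2).Adj (sh E₁) O₁ ∧ (zdGraph 2).Adj (sh E₁) O₂ ∧ O₁ ∈ extCols z tD sD ∧ O₂ ∈ extCols z tD sD := by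
  have hE : Even (sh E₁ 0 + sh E₁ 1) := even_of_twins hT.ne hs
  obtain ⟨o₁, a₁, a₂, o₂, ho₁, ha₁, ha₂, ho₂, ho₁W, ho₂W, hwo₁, hwa₁, -, hwo₂, n_a₁o₁, -, n_a₂o₂, -, n_o₁o₂, n_o₁a₂, n_a₁o₂, haa,
    hw₁, hw₂, hw₃, hw₄⟩ := hT.nbrs
  -- the four neighbours, as neighbours of `E₁` or of its twin `E₂`
  have ho₁' : (slabGraph 2).Adj E₁ o₁ := ho₁.symm
  have ha₂' : (slabGraph 2).Adj E₂ a₂ := ha₂.symm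
  -- lattice adjacency of their columns to `A = sh E₁`
  have adj_o₁ : (zdGraph 2).Adj (sh E₁) (sh o₁) := sh_step ho₁'
  have adj_a₁ : (zdGraph 2).Adj (sh E₁) (sh a₁) := sh_step ha₁
  have adj_a₂ : (zdGraph 2).Adj (sh E₁) (sh a₂) := by rw [hs]; exact sh_step ha₂'
  have adj_o₂ : (zdGraph 2).Adj (sh E₁) (sh o₂) := by rw [hs]; exact sh_step ho₂
  -- `a₁ ≠ a₂`: otherwise `sh a₁ = z`, the column of `E₁` is next to the centre and the exterior vertex `o₁` would be cleared
  have haa' : a₁ ≠ a₂ := by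
    intro h
    have hz : sh a₁ = z := haa h
    apply ho₁W
    show sh o₁ ∈ Dcols z tD sD
    refine mem_Dcols_of_sqBall_two hts ?_ (inWin_mono hsRD hwo₁)
    have e0 := abs_le.1 (abs_sh_sub_le_one ha₁ 0)
    have e1 := abs_le.1 (abs_sh_sub_le_one ha₁ 1)
    have f0 := abs_le.1 (abs_sh_sub_le_one ho₁' 0)
    have f1 := abs_le.1 (abs_sh_sub_le_one ho₁' 1)
    rw [hz] at e0 e1
    rw [mem_sqBall_iff_linear]
    push_cast
    omega
  -- pairwise distinct columns
  have d_o₁a₁ : sh o₁ ≠ sh a₁ := sh_ne_of_adj_twins hE rfl ho₁' ha₁ (Ne.symm n_a₁o₁)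
  have d_o₁a₂ : sh o₁ ≠ sh a₂ := sh_ne_of_adj_twins hE hs ho₁' ha₂' n_o₁a₂
  have d_o₁o₂ : sh o₁ ≠ sh o₂ := sh_ne_of_adj_twins hE hs ho₁' ho₂ n_o₁o₂
  have d_a₁a₂ : sh a₁ ≠ sh a₂ := sh_ne_of_adj_twins hE hs ha₁ ha₂' haa'
  have d_a₁o₂ : sh a₁ ≠ sh o₂ := sh_ne_of_adj_twins hE hs ha₁ ho₂ n_a₁o₂
  have d_a₂o₂ : sh a₂ ≠ sh o₂ := sh_ne_of_adj_twins (by rw [← hs]; exact hE) rfl ha₂' ho₂ n_a₂o₂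
  refine ⟨fun hadj => not_five_nbrs hadj adj_o₁ adj_a₁ adj_a₂ adj_o₂ hw₁ hw₂ hw₃ hw₄ d_o₁a₁ d_o₁a₂ d_o₁o₂ d_a₁a₂ d_a₁o₂ d_a₂o₂,
    sh o₁, sh o₂, d_o₁o₂, adj_o₁, adj_o₂, ⟨inWin_mono hsRD hwo₁, ho₁W⟩, ⟨inWin_mono hsRD hwo₂, ho₂W⟩⟩

/-- **REDUCTION (`k = 2`): column-level routing with the twin side conditions gives the exit-form certificate `ShapedLinkageX 3`** with the cleared
set `W = lift (block ∖ corners)` — as «BccSlabClearedSetX».`shapedLinkageX_of_colRouting`, plus `twin_conditions`.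
[cite: DuminilCopinSidoraviciusTassion2016, §2.3 (proof of Fact 2)] -/
theorem shapedLinkageX_two_of_colRoutingTwin (H : ColRoutingTwin 2) : (sqShadow 2).ShapedLinkageX 3 := by
  intro z tR tD sR sD htRD hsRD hone
  have hts : 3 ≤ tD ∨ 3 ≤ sD := hone.imp (fun h => h.trans htRD) (fun h => h.trans hsRD)
  refine ⟨clearedSet 2 z tD sD, sh_mem_sqBlkR_of_mem_clearedSet, mem_clearedSet_of_sqBall_one hts, fun E₁ E₂ w' hT => ?_⟩
  obtain ⟨o₁, a₁, a₂, o₂, ho₁, -, -, ho₂, ho₁W, ho₂W, hwo₁, -, -, hwo₂, -⟩ := hT.nbrs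
  obtain ⟨x, hx, hxW, hxwin, -, -, -⟩ := hT.w'x
  have hT₁ : sh E₁ ∈ tgtCols z tD sD := tgtCol_of_adj hT.E₁W ho₁.symm ho₁W (inWin_mono hsRD hwo₁)
  have hT₂ : sh E₂ ∈ tgtCols z tD sD := tgtCol_of_adj hT.E₂W ho₂ ho₂W (inWin_mono hsRD hwo₂)
  have hT₃ : sh w' ∈ tgtCols z tD sD := tgtCol_of_adj hT.w'W hx hxW hxwin
  exact H z tR tD sR sD htRD hsRD hone E₁ E₂ w' hT.ne hT₁ hT.E₁R hT.E₁z hT₂ hT.E₂R hT.E₂z hT₃ hT.w'E₁ hT.w'E₂ (twin_conditions hsRD hts hT)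

/-- **`θ_{S_2(bcc)}(v, p_c(S_2(bcc))) = 0` FROM `ColRoutingTwin 2`** — p205010-free (the square DST layer «SqShadow*» with the thin-instance routing «SqShadowVRoutingX»,
the cleared set of «BccSlabClearedSetX»). [cite: DuminilCopinSidoraviciusTassion2016, Thm. 1 and §2.3] [cite: BenjaminiSchramm1996, Conj. 4 / Question 3] -/
theorem theta_criticalProb_eq_zero_two_of_colRoutingTwin (H : ColRoutingTwin 2) (v : bslab 2) :
    theta (slabGraph 2) v (criticalProbIOf (slabGraph 2) v) = 0 :=
  theta_criticalProb_eq_zero_of_shapedLinkageX (k := 2) (by norm_num) (by norm_num : (1 : ℕ) ≤ 3) (shapedLinkageX_two_of_colRoutingTwin H) v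

end BccSlab

end Summit.CriticalPhenomena.PercolationContinuityZ3.Theorems.Transplant

end
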